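import Mathlib
import Literature.Computability.Complexity.ExtMonotoneGates
import Literature.Computability.Complexity.CircuitPlug
import Literature.Computability.Complexity.CircuitInputMap
import Literature.Computability.Complexity.CircuitRestriction

/-!
# Route ConvexRankGates — crux `LinAlgGateBlind` (stmt-PneNP-10681), support:
# projection closure of circuits over a basis with constant gates (in particular the crux basis)

Line `perm-door-lifted-closure-programs` of the crux chain plants a lifted CSP into CLIQUE; its
registered stub `stub_transfer` ("provable now, L") restricts a `CLIQUE(m,k)` circuit over the crux
basis `{∧₂, ∨₂} ∪ PERM_s ∪ GRANK_s` along a projection (hub edges ↦ inputs, other edges ↦ constants),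
citing `Circuit.mapInputs` (variable-for-variable; `CircuitInputMap`) and the constants
`true ∈ PERM_0`, `false ∈ GRANK_0`. The tree's restriction theorem `Circuit.exists_restrict` is for
the AC basis only (constants are absorbed into unbounded `∧`/`∨`). This file supplies the general,
definition-free form for ANY basis containing the two constant gates, by the explicit plug calculus
of `CircuitPlug` (two constant gates first, then the whole circuit relocated behind them with every
restricted input wire redirected to the matching constant):

* `exists_restrict_of_const_mem` — for `C` over `B ∋ const false, const true` and a partial
  assignment `ρ`, a circuit over `B` with `C.size + 2` gates computing `x ↦ C (x|_ρ)`.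
* `exists_project_of_const_mem` — the same followed by a renaming `e : ι → κ` of the free inputs:
  `u ↦ C ((u ∘ e)|_ρ)` (full projection closure: variables to variables or constants).
* `const_true_isPermGate`, `const_false_isGRankGate`, `const_mem_cruxBasis` — the constant gates lie
  in the crux basis for every size parameter `s` (`true` = membership of `1` in a subgroup of
  `Sym(0)`; `false` = "rank of the `0 × 0` symbolic matrix is `≥ 1`" over `ℚ`).
* `exists_project_cruxBasis` — projection closure of the crux basis (registered form): for every
  `C` over `{∧₂, ∨₂} ∪ PERM_s ∪ GRANK_s`, every `ρ` and `e`, a circuit over the same basis with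
  `C.size + 2` gates computing `u ↦ C ((u ∘ e)|_ρ)`.

Sources: H. Vollmer, *Introduction to Circuit Complexity* (1999), §1.2 (projections, composition);
the plug calculus is the tree's. [folklore]
-/

namespace Summit.PneNP.PneNP.Theorems

open Finset Literature.Computability.Complexity Literature.Computability.Complexity.GateList

/-- **Restriction closure for bases with constants.** If the basis `B` contains the two constant
gates `GateFn.const b`, then for every circuit `C` over `B` and every partial assignment `ρ` of its
inputs there is a circuit over `B` with `C.size + 2` gates computing `x ↦ C (x|_ρ)`
(`restrictInput ρ x`). Construction: the program `[const false, const true]` followed by the gates of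
`C` relocated behind it, the input wire `i` redirected to the constant `b` when `ρ i = some b`
(`GateList.plug`). [folklore] -/
theorem exists_restrict_of_const_mem {ι : Type*} {B : Set GateFn}
    (hB : ∀ b : Bool, GateFn.const b ∈ B) (C : Circuit ι) (hC : C.IsOver B) (ρ : ι → Option Bool) :
    ∃ D : Circuit ι, D.IsOver B ∧ D.size = C.size + 2 ∧
      ∀ x, D.eval x = C.eval (restrictInput ρ x) := by
  classical
  -- the two constant gates
  let g0 : Gate ι := ⟨0, fun _ => false, Fin.elim0⟩
  let g1 : Gate ι := ⟨0, fun _ => true, Fin.elim0⟩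
  let gs : List (Gate ι) := [g0] ++ [g1]
  have hwf0 : WF [g0] := by
    simpa using wf_snoc (gs := ([] : List (Gate ι))) WF.nil (g := g0) fun a => a.elim0
  have hwf : WF gs := wf_snoc hwf0 fun a => a.elim0
  -- their wires, at a common depth bound `d`
  let d0 : ℕ := acWeight g0.fn + univ.sup fun a =>
    wireDepthOf (wdepths acWeight ([] : List (Gate ι))) (g0.args a)
  let d1 : ℕ := acWeight g1.fn + univ.sup fun a => wireDepthOf (wdepths acWeight [g0]) (g1.args a)
  have hc0' : Carries ([] ++ [g0]) (Sum.inr 0) (fun _ : ι → Bool => false) d0 :=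
    carries_snoc [] g0 (fun _ => rfl) le_rfl
  have hc0 : Carries gs (Sum.inr 0) (fun _ : ι → Bool => false) d0 := by
    simpa [gs] using hc0'.append [g1]
  have hc1 : Carries gs (Sum.inr 1) (fun _ : ι → Bool => true) d1 :=
    carries_snoc [g0] g1 (fun _ => rfl) le_rfl
  let d : ℕ := max d0 d1
  -- redirect the restricted inputs
  let ρ' : ι → ι ⊕ ℕ := fun i => match ρ i with
    | none => Sum.inl i
    | some false => Sum.inr 0
    | some true => Sum.inr 1
  have hcar : ∀ i, Carries gs (ρ' i) (fun x => restrictInput ρ x i) d := by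
    intro i
    simp only [ρ', restrictInput]
    rcases hρ : ρ i with _ | _ | _
    · simpa [hρ] using (carries_input gs i).mono (Nat.zero_le d)
    · simpa [hρ] using hc0.mono (le_max_left _ _)
    · simpa [hρ] using hc1.mono (le_max_right _ _)
  have hplug := carries_plug C hcar
  have hρ' : WiresOK gs.length ρ' := fun i m hm => (hcar i).outOK m hm
  refine ⟨toCircuit (plug gs ρ' C).1 (plug gs ρ' C).2 (wf_plug hwf hρ' C) hplug.outOK,
    isOver_toCircuit _ _ (fn_mem_plug (fun g hg => ?_) ρ' hC), ?_, fun x => eval_toCircuit _ hplug x⟩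
  · -- the two constant gates lie in `B`
    simp only [gs, List.singleton_append, List.mem_cons, List.not_mem_nil, or_false] at hg
    rcases hg with rfl | rfl
    · exact hB false
    · exact hB true
  · rw [size_toCircuit, length_plug]
    simp [gs, add_comm]

/-- **Projection closure for bases with constants**: restriction followed by a renaming of the
free inputs — `u ↦ C ((u ∘ e)|_ρ)` is computed over `B` with `C.size + 2` gates. [folklore] -/
theorem exists_project_of_const_mem {ι κ : Type*} {B : Set GateFn}
    (hB : ∀ b : Bool, GateFn.const b ∈ B) (C : Circuit ι) (hC : C.IsOver B) (ρ : ι → Option Bool)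
    (e : ι → κ) :
    ∃ D : Circuit κ, D.IsOver B ∧ D.size = C.size + 2 ∧
      ∀ u, D.eval u = C.eval (restrictInput ρ fun i => u (e i)) := by
  obtain ⟨D, hD, hs, hev⟩ := exists_restrict_of_const_mem hB C hC ρ
  exact ⟨D.mapInputs e, hD.mapInputs e, by simpa using hs, fun u => by
    rw [Circuit.eval_mapInputs, hev]⟩

/-- The constant `true` is a PERM gate of every size parameter: membership of `1` in a subgroup of
`Sym(0)`. [folklore] -/
theorem const_true_isPermGate (s : ℕ) : IsPermGate s (GateFn.const true) :=
  ⟨0, Nat.zero_le s, Fin.elim0, 1, fun _ => ⟨fun _ => Subgroup.one_mem _, fun _ => rfl⟩⟩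

/-- The constant `false` is a GRANK gate of every size parameter: "the `0 × 0` symbolic matrix has
rank `≥ 1`" (over `ℚ`). [folklore] -/
theorem const_false_isGRankGate (s : ℕ) : IsGRankGate s (GateFn.const false) := by
  refine ⟨ℚ, inferInstance, 0, 1, Nat.zero_le s, 0, Fin.elim0, fun v => ?_⟩
  constructor
  · intro h
    exact absurd h Bool.false_ne_true
  · intro h
    have h0 : (symbolicMatrix (0 : Matrix (Fin 0) (Fin 0) ℚ) Fin.elim0 v).rank ≤ 0 :=
      (Matrix.rank_le_card_width _).trans_eq (Fintype.card_fin 0)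
    exact absurd (h.trans h0) (by norm_num)

/-- Both constant gates lie in the crux basis `{∧₂, ∨₂} ∪ PERM_s ∪ GRANK_s`. [folklore] -/
theorem const_mem_cruxBasis (s : ℕ) (b : Bool) :
    GateFn.const b ∈ ({GateFn.and 2, GateFn.or 2} ∪ {g | IsPermGate s g ∨ IsGRankGate s g} :
      Set GateFn) := by
  cases b
  · exact Or.inr (Or.inr (const_false_isGRankGate s))
  · exact Or.inr (Or.inl (const_true_isPermGate s))

/-- **Projection closure of the crux basis** (registered form, for the transfer stub of line
`perm-door-lifted-closure-programs`): for every circuit `C` over `{∧₂, ∨₂} ∪ PERM_s ∪ GRANK_s`, every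
partial assignment `ρ` of its inputs and every renaming `e` of the free inputs, there is a circuit
over the same basis with `C.size + 2` gates computing `u ↦ C ((u ∘ e)|_ρ)`. [folklore] -/
theorem exists_project_cruxBasis : ∀ {ι κ : Type} (s : ℕ) (C : Circuit ι),
    C.IsOver ({GateFn.and 2, GateFn.or 2} ∪ {g | IsPermGate s g ∨ IsGRankGate s g}) →
    ∀ (ρ : ι → Option Bool) (e : ι → κ), ∃ D : Circuit κ,
      D.IsOver ({GateFn.and 2, GateFn.or 2} ∪ {g | IsPermGate s g ∨ IsGRankGate s g}) ∧
        D.size = C.size + 2 ∧ ∀ u, D.eval u = C.eval (restrictInput ρ fun i => u (e i)) := by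
  intro ι κ s C hC ρ e
  exact exists_project_of_const_mem (const_mem_cruxBasis s) C hC ρ e

end Summit.PneNP.PneNP.Theorems
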